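import Literature.MathematicalPhysics.QuantumFieldTheory.ConformalBootstrap3D.CasimirRecursionPivots
import Mathlib.Data.Finset.NatAntidiagonal
import Mathlib.Algebra.BigOperators.Group.Finset.Basic
import Mathlib.Tactic.Linarith
import Mathlib.Tactic.Ring
import Mathlib.Tactic.Positivity
import Mathlib.Tactic.FieldSimp
import HarnessLib

/-!
# Uniqueness of 3D conformal-block coefficients: the Casimir recursion is triangular in the monomial basis

The genuine-block predicate `IsConformalBlock3DAbove Δ₁₂ Δ₃₄ Δ ℓ g` of `SigmaEpsilonSystem.lean` writes
`g = (z z̄)^α K`, `α = (Δ-ℓ)/2`, `K = Σ_{m,n} k_{mn} z^m z̄^n` (symmetric double power series) with the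
Dolan–Osborn boundary condition `HasLeadingPart ℓ k` and the quadratic Casimir equation `CasimirEq3D`
(Dolan–Osborn 2011, eqs. (2.10)–(2.12), multiplied by `(z - z̄)`). Substituting the double series into
the Casimir equation and comparing the coefficient of `z^{P+α} z̄^{Q+α}` gives, for EVERY `(P, Q) ∈ ℕ²`,
one linear equation among at most five coefficients (this file's `coeffCasimirLHS … k P Q = 0`):

  `A(P-1,Q) k_{P-1,Q} + B(P,Q-1) k_{P,Q-1} + C(P-2) k_{P-2,Q} + D(P-1,Q-1) k_{P-1,Q-1} + E(Q-2) k_{P,Q-2} = 0`,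

terms with a negative index absent, where for a source coefficient `k_{mn}` with exponents
`p = m + α`, `q = n + α` and `a = -Δ₁₂/2`, `b = Δ₃₄/2`, `c = casimirEigenvalue3D Δ ℓ`:
`A = p(p-1) + q(q-1) - c - q`, `B = -[p(p-1) + q(q-1) - c] + p`, `C = -(p+a)(p+b)`,
`D = (p+a)(p+b) - (q+a)(q+b) - p + q`, `E = (q+a)(q+b)` (from `D_x(a,b) x^p = p(p-1) x^p - (p+a)(p+b) x^{p+1}`,
Dolan–Osborn 2011 eq. (2.11), and the first-order term `z z̄[(1-z)∂_z - (1-z̄)∂_z̄]`). The derivation of this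
coefficient system from the PDE on the open square (termwise differentiation of the double series and the
identity theorem) is NOT in this file; here the system `SatisfiesCoeffCasimir a b Δ ℓ k` is the hypothesis.

What IS proved here — the uniqueness half (U) of pub-ising3d REFEREE T1 (finding F23), with one
simplification over F23: no Gegenbauer diagonalisation is needed, because in the MONOMIAL basis the
equations of output degree `N + 1` already form a lower-bidiagonal (triangular) square system for the
degree-`N` unknowns `u_Q = k_{N-Q,Q}`, `0 ≤ 2Q ≤ N` (equation `(N+1-Q, Q)` contains `u_Q` with coefficient
`A(N-Q,Q)`, `u_{Q-1}`, and degree-`N-1` coefficients only), and its diagonal entries are EXACTLY half the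
Hogervorst–Rychkov pivots:

* `coeffA_eq` — `A(m,n) = (m+n-ℓ)Δ + (m-ℓ)(m-1) + n(n-ℓ-2)` (the `Δ²` cancels: linear in `Δ`);
* `two_mul_coeffA_eq_casimirPivot3D` — for `m + n = ℓ + n'`, `m = n + j`:
  `2 A(m,n) = casimirPivot3D Δ ℓ n' j = C_{Δ+n',j} - C_{Δ,ℓ}` (Hogervorst–Rychkov 2013, §3–4), i.e. the
  degree-`N` pivots are the HR pivots of level `n' = N - ℓ` at spins `j = N - 2Q ≡ N (mod 2)`, `0 ≤ j ≤ N`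
  — the FULL range `j ≤ ℓ + n'` of `accidentalDegeneracy3D`, unreachable seeds `j < ℓ - n'` included
  (this is why the exceptional set of the predicate is what it is: F20/F23);
* `coeffA_ne_zero_of_lt` (`N < ℓ`: `A < 0` above the unitarity bound — negative levels never degenerate),
  `coeffA_eq_of_deg_eq` (`N = ℓ`: `A(m,n) = -n(2m+1)`, zero only at the seed `n = 0`, which
  `HasLeadingPart` normalises), `coeffA_ne_zero_of_gt` (`N > ℓ`: `A ≠ 0` off `accidentalDegeneracy3D`);
* `SatisfiesCoeffCasimir.degree_step` — the triangular induction inside one degree;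
* `SatisfiesCoeffCasimir.eq_zero_of_deg_lt` — every symmetric solution vanishes below degree `ℓ`
  (above the bound; no boundary condition needed);
* `SatisfiesCoeffCasimir.unique` — **(U)**: strictly above the 3D unitarity bound and off
  `accidentalDegeneracy3D Δ ℓ`, two symmetric solutions with `HasLeadingPart ℓ` are EQUAL (all `a, b`);
* `diagCoeff k N = Σ_{m+n=N} k_{mn}` (the coefficient of `x^{N+2α}` in `g(x,x)`), equal for two solutions
  and zero for `N < ℓ`.

The pivots do not depend on `(a, b)`: uniqueness holds verbatim for the unequal-dimension blocks of the
`σ×ε` channel. What is NOT here: the analytic extraction PDE ⇒ `SatisfiesCoeffCasimir` (REFEREE T1 (α));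
existence / identification of the solution with the Hogervorst–Rychkov `z`-series `hrCoeff`
(`ZSeriesBlockCoefficients.lean`; the Legendre change of basis `k_{mn} = λ_ℓ⁻¹ Σ_j A_{N-ℓ,j} λ_i λ_{j-i}`,
`λ_i = C(2i,i)/4^i`, checked in exact arithmetic at regular points in pub-ising3d
`code/monomial_recursion_check.py`, is REFEREE T1 (E), not formalised); any value of a block.

Sources: F. A. Dolan, H. Osborn, arXiv:1108.6194 (2011), §2 eqs. (2.10)–(2.12); M. Hogervorst,
S. Rychkov, Phys. Rev. D 87 (2013) 106004, §3 (recursion (3.9), pivots) and §4; the pub-ising3d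
referee findings F20/F23 (structure of the exceptional set). Mathlib: `Finset.antidiagonal`,
`Nat.strong_induction_on`; no conformal-block material exists in Mathlib.
-/

namespace Literature.MathematicalPhysics.QuantumFieldTheory.ConformalBootstrap3D

open Finset

/-! ### The coefficient system -/

/-- The half-twist exponent `α = (Δ - ℓ)/2` of the ansatz `g = (z z̄)^α K` in
`IsConformalBlock3DAbove`. [cite: DolanOsborn2011, §2 eq. (2.9)] -/
noncomputable def halfTwist (Δ : ℝ) (ℓ : ℕ) : ℝ :=
  (Δ - (ℓ : ℝ)) / 2

/-- Weight `A(m,n) = p(p-1) + q(q-1) - c - q`, `p = m+α`, `q = n+α`: the coefficient with which `k_{mn}`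
enters the equation of the monomial `z^{m+1+α} z̄^{n+α}` (from `z·[D_z + D_z̄ - c]` and `-z·z̄∂_z̄`).
Independent of `(a,b)`. [cite: DolanOsborn2011, §2 eqs. (2.10)–(2.12)] -/
noncomputable def coeffA (Δ : ℝ) (ℓ m n : ℕ) : ℝ :=
  ((m : ℝ) + halfTwist Δ ℓ) * ((m : ℝ) + halfTwist Δ ℓ - 1)
      + ((n : ℝ) + halfTwist Δ ℓ) * ((n : ℝ) + halfTwist Δ ℓ - 1)
    - casimirEigenvalue3D Δ ℓ - ((n : ℝ) + halfTwist Δ ℓ)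

/-- Weight `B(m,n) = -[p(p-1) + q(q-1) - c] + p`: the coefficient with which `k_{mn}` enters the equation
of `z^{m+α} z̄^{n+1+α}` (from `-z̄·[D_z + D_z̄ - c]` and `+z̄·z∂_z`). One has `B(n,m) = -A(m,n)`
(`coeffB_eq_neg_coeffA`). [cite: DolanOsborn2011, §2 eqs. (2.10)–(2.12)] -/
noncomputable def coeffB (Δ : ℝ) (ℓ m n : ℕ) : ℝ :=
  -(((m : ℝ) + halfTwist Δ ℓ) * ((m : ℝ) + halfTwist Δ ℓ - 1)
      + ((n : ℝ) + halfTwist Δ ℓ) * ((n : ℝ) + halfTwist Δ ℓ - 1) - casimirEigenvalue3D Δ ℓ)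
    + ((m : ℝ) + halfTwist Δ ℓ)

/-- Weight `C(m) = -(p+a)(p+b)`, `p = m+α`: coefficient of `k_{mn}` in the equation of `z^{m+2+α} z̄^{n+α}`
(from `z · (-z (θ_z+a)(θ_z+b))`, `D_x(a,b) x^p = p(p-1)x^p - (p+a)(p+b)x^{p+1}`).
[cite: DolanOsborn2011, §2 eq. (2.11)] -/
noncomputable def coeffC (a b Δ : ℝ) (ℓ m : ℕ) : ℝ :=
  -(((m : ℝ) + halfTwist Δ ℓ + a) * ((m : ℝ) + halfTwist Δ ℓ + b))

/-- Weight `D(m,n) = (p+a)(p+b) - (q+a)(q+b) - p + q`: coefficient of `k_{mn}` in the equation of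
`z^{m+1+α} z̄^{n+1+α}`. Antisymmetric in `(m,n)`. [cite: DolanOsborn2011, §2 eqs. (2.10)–(2.12)] -/
noncomputable def coeffD (a b Δ : ℝ) (ℓ m n : ℕ) : ℝ :=
  ((m : ℝ) + halfTwist Δ ℓ + a) * ((m : ℝ) + halfTwist Δ ℓ + b)
      - ((n : ℝ) + halfTwist Δ ℓ + a) * ((n : ℝ) + halfTwist Δ ℓ + b)
    - ((m : ℝ) + halfTwist Δ ℓ) + ((n : ℝ) + halfTwist Δ ℓ)

/-- Weight `E(n) = (q+a)(q+b)`, `q = n+α`: coefficient of `k_{mn}` in the equation of `z^{m+α} z̄^{n+2+α}`.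
[cite: DolanOsborn2011, §2 eq. (2.11)] -/
noncomputable def coeffE (a b Δ : ℝ) (ℓ n : ℕ) : ℝ :=
  ((n : ℝ) + halfTwist Δ ℓ + a) * ((n : ℝ) + halfTwist Δ ℓ + b)

/-- The left-hand side of the coefficient equation of the monomial `z^{P+α} z̄^{Q+α}` in the quadratic
Casimir equation `(z - z̄)[D_z g + D_z̄ g - c g] + z z̄[(1-z)∂_z g - (1-z̄)∂_z̄ g] = 0` for
`g = (z z̄)^α Σ k_{mn} z^m z̄^n`: the five coefficients `k_{P-1,Q}`, `k_{P,Q-1}`, `k_{P-2,Q}`,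
`k_{P-1,Q-1}`, `k_{P,Q-2}` (those with a negative index are absent) with the weights `A, B, C, D, E`.
[cite: DolanOsborn2011, §2 eqs. (2.10)–(2.12)] -/
noncomputable def coeffCasimirLHS (a b Δ : ℝ) (ℓ : ℕ) (k : ℕ × ℕ → ℝ) (P Q : ℕ) : ℝ :=
  (if 1 ≤ P then coeffA Δ ℓ (P - 1) Q * k (P - 1, Q) else 0) +
    (if 1 ≤ Q then coeffB Δ ℓ P (Q - 1) * k (P, Q - 1) else 0) +
    (if 2 ≤ P then coeffC a b Δ ℓ (P - 2) * k (P - 2, Q) else 0) +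
    (if 1 ≤ P ∧ 1 ≤ Q then coeffD a b Δ ℓ (P - 1) (Q - 1) * k (P - 1, Q - 1) else 0) +
    (if 2 ≤ Q then coeffE a b Δ ℓ (Q - 2) * k (P, Q - 2) else 0)

/-- **The Casimir equation on the coefficient array** `k` of `K` (all monomials `(P, Q) ∈ ℕ²`), for the
block of `(Δ, ℓ)` with `a = -Δ₁₂/2`, `b = Δ₃₄/2`. This is what the quadratic Casimir equation of
`IsConformalBlock3DAbove` says coefficientwise (the extraction itself is pub-ising3d REFEREE T1 (α), not in
this file). [cite: DolanOsborn2011, §2 eqs. (2.10)–(2.12)] -/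
def SatisfiesCoeffCasimir (a b Δ : ℝ) (ℓ : ℕ) (k : ℕ × ℕ → ℝ) : Prop :=
  ∀ P Q : ℕ, coeffCasimirLHS a b Δ ℓ k P Q = 0

/-- The diagonal coefficient `d_N = Σ_{m+n=N} k_{mn}`: the coefficient of `x^{N+2α}` in
`g(x,x) = x^{2α} K(x,x)`, the quantity a diagonal point-evaluation certificate needs.
[cite: HogervorstRychkov2013, §3 eq. (3.4)] -/
def diagCoeff (k : ℕ × ℕ → ℝ) (N : ℕ) : ℝ :=
  ∑ p ∈ antidiagonal N, k p

/-! ### The pivots -/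

/-- Closed form of the pivot weight: `A(m,n) = (m+n-ℓ)Δ + (m-ℓ)(m-1) + n(n-ℓ-2)` — the `Δ²` of `p², q²`
cancels against the Casimir eigenvalue, so the pivot is LINEAR in `Δ`. [cite: HogervorstRychkov2013, §4 after eq. (4.7)] -/
theorem coeffA_eq (Δ : ℝ) (ℓ m n : ℕ) :
    coeffA Δ ℓ m n =
      ((m : ℝ) + (n : ℝ) - (ℓ : ℝ)) * Δ + ((m : ℝ) - (ℓ : ℝ)) * ((m : ℝ) - 1)
        + (n : ℝ) * ((n : ℝ) - (ℓ : ℝ) - 2) := by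
  unfold coeffA halfTwist casimirEigenvalue3D
  ring

/-- `B(n,m) = -A(m,n)`: the equation of `z^{P} z̄^{Q}` and that of `z^{Q} z̄^{P}` are negatives of each
other on a symmetric array (the Casimir form multiplied by `z - z̄` is antisymmetric). [folklore] -/
theorem coeffB_eq_neg_coeffA (Δ : ℝ) (ℓ m n : ℕ) : coeffB Δ ℓ n m = -coeffA Δ ℓ m n := by
  unfold coeffA coeffB
  ring

/-- **The monomial pivots are the Hogervorst–Rychkov pivots.** For a degree-`N` position `(m,n)`,
`N = m + n = ℓ + n'`, `m = n + j` (so `j = N - 2Q` at `Q = n`):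
`2·A(m,n) = casimirPivot3D Δ ℓ n' j = 2n'Δ + n'(n'-3) + j(j+1) - ℓ(ℓ+1)`.
(Hogervorst–Rychkov 2013, §3: the factor `C_{Δ+n,j} - C_{Δ,ℓ}` of the recursion (3.9).)
[cite: HogervorstRychkov2013, §3 eq. (3.9)] -/
theorem two_mul_coeffA_eq_casimirPivot3D (Δ : ℝ) {ℓ m n n' j : ℕ} (hj : m = n + j)
    (hN : m + n = ℓ + n') : 2 * coeffA Δ ℓ m n = casimirPivot3D Δ ℓ n' j := by
  have hℓ : (ℓ : ℝ) = (m : ℝ) + (n : ℝ) - (n' : ℝ) := by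
    have h := congrArg (Nat.cast : ℕ → ℝ) hN
    push_cast at h
    linarith
  have hm : (m : ℝ) = (n : ℝ) + (j : ℝ) := by exact_mod_cast hj
  rw [coeffA_eq]
  unfold casimirPivot3D
  rw [hℓ, hm]
  ring

/-- Degree `N = ℓ` (level `0`): `A(m,n) = -n(2m+1)` for `m + n = ℓ`; it vanishes only at the seed
position `n = 0` (the coefficient `k_{ℓ0}` fixed by `HasLeadingPart`). [cite: HogervorstRychkov2013, §3 eq. (3.9)] -/
theorem coeffA_eq_of_deg_eq (Δ : ℝ) {ℓ m n : ℕ} (hN : m + n = ℓ) :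
    coeffA Δ ℓ m n = -(n : ℝ) * (2 * (m : ℝ) + 1) := by
  have hℓ : (ℓ : ℝ) = (m : ℝ) + (n : ℝ) := by exact_mod_cast hN.symm
  rw [coeffA_eq, hℓ]
  ring

/-- Degree `N = ℓ`, `n ≥ 1`: the pivot is non-zero. [cite: HogervorstRychkov2013, §3 eq. (3.9)] -/
theorem coeffA_ne_zero_of_deg_eq (Δ : ℝ) {ℓ m n : ℕ} (hN : m + n = ℓ) (hn : 1 ≤ n) :
    coeffA Δ ℓ m n ≠ 0 := by
  rw [coeffA_eq_of_deg_eq Δ hN]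
  have hn' : (1 : ℝ) ≤ (n : ℝ) := by exact_mod_cast hn
  have hm' : (0 : ℝ) ≤ (m : ℝ) := by exact_mod_cast Nat.zero_le m
  nlinarith

/-- **Negative levels never degenerate.** Below degree `ℓ` (`m + n < ℓ`, so `ℓ ≥ 1`) and strictly above
the unitarity bound `Δ > ℓ + 1`, the pivot is negative, in particular non-zero: writing `ℓ = m+n+t`,
`t ≥ 1`, `A = -tΔ - (n+t)(m-1) - n(m+t+2)`, and `Δ > m+n+t+1`. (pub-ising3d REFEREE F23: "negative levels
never degenerate for `Δ > 0`" on the relevant components; here in the form needed, above the bound.)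
[cite: HogervorstRychkov2013, §3 eq. (3.9)] -/
theorem coeffA_neg_of_lt {Δ : ℝ} {ℓ m n : ℕ} (hΔ : unitarityBound3D ℓ < Δ) (hN : m + n < ℓ) :
    coeffA Δ ℓ m n < 0 := by
  have hℓ1 : 1 ≤ ℓ := by omega
  have hΔ' : (ℓ : ℝ) + 1 < Δ := cast_add_one_lt_of_unitarityBound3D_lt hℓ1 hΔ
  obtain ⟨t, ht⟩ : ∃ t : ℕ, ℓ = m + n + t := ⟨ℓ - (m + n), by omega⟩
  have ht1 : 1 ≤ t := by omega
  subst ht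
  rw [coeffA_eq]
  push_cast at hΔ' ⊢
  have ht1' : (1 : ℝ) ≤ (t : ℝ) := by exact_mod_cast ht1
  have hn0 : (0 : ℝ) ≤ (n : ℝ) := by exact_mod_cast Nat.zero_le n
  have hm0 : (0 : ℝ) ≤ (m : ℝ) := by exact_mod_cast Nat.zero_le m
  rcases Nat.eq_zero_or_pos m with hm | hm
  · subst hm
    have hn : n = 0 ∨ 1 ≤ n := by omega
    rcases hn with hn | hn
    · subst hn
      push_cast
      nlinarith
    · have hn1 : (1 : ℝ) ≤ (n : ℝ) := by exact_mod_cast hn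
      push_cast
      nlinarith
  · have hm1 : (1 : ℝ) ≤ (m : ℝ) := by exact_mod_cast hm
    nlinarith

/-- Below degree `ℓ`, above the bound: `A(m,n) ≠ 0`. [cite: HogervorstRychkov2013, §3 eq. (3.9)] -/
theorem coeffA_ne_zero_of_lt {Δ : ℝ} {ℓ m n : ℕ} (hΔ : unitarityBound3D ℓ < Δ) (hN : m + n < ℓ) :
    coeffA Δ ℓ m n ≠ 0 :=
  ne_of_lt (coeffA_neg_of_lt hΔ hN)

/-- **Above degree `ℓ`, off the accidental-degeneracy set: `A(m,n) ≠ 0`** (for `n ≤ m`, i.e. the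
positions `(N-Q, Q)` with `2Q ≤ N` that the triangular induction visits). Indeed `2A` is the pivot
`casimirPivot3D Δ ℓ n' j` with `n' = m+n-ℓ ≥ 1`, `j = m-n ≤ ℓ+n'`, `j + ℓ + n' = 2m` even — a witness of
`accidentalDegeneracy3D Δ ℓ` if it vanished. No unitarity bound is needed for this case.
[cite: HogervorstRychkov2013, §3 eq. (3.9)] -/
theorem coeffA_ne_zero_of_gt {Δ : ℝ} {ℓ m n : ℕ} (hreg : ¬ accidentalDegeneracy3D Δ ℓ)
    (hN : ℓ < m + n) (hnm : n ≤ m) : coeffA Δ ℓ m n ≠ 0 := by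
  intro h0
  apply hreg
  refine ⟨m + n - ℓ, m - n, by omega, by omega, by omega, ?_⟩
  have h2 := two_mul_coeffA_eq_casimirPivot3D Δ (ℓ := ℓ) (m := m) (n := n) (n' := m + n - ℓ)
    (j := m - n) (by omega) (by omega)
  rw [h0, mul_zero] at h2
  exact h2.symm

/-! ### Linearity of the system -/

/-- The coefficient equation is linear in the array: difference of two arrays. [folklore] -/
theorem coeffCasimirLHS_sub (a b Δ : ℝ) (ℓ : ℕ) (k k' : ℕ × ℕ → ℝ) (P Q : ℕ) :
    coeffCasimirLHS a b Δ ℓ (k - k') P Q =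
      coeffCasimirLHS a b Δ ℓ k P Q - coeffCasimirLHS a b Δ ℓ k' P Q := by
  simp only [coeffCasimirLHS, Pi.sub_apply]
  split_ifs <;> ring

/-- Two solutions give a solution of the (same, homogeneous) system by subtraction. [folklore] -/
theorem SatisfiesCoeffCasimir.sub {a b Δ : ℝ} {ℓ : ℕ} {k k' : ℕ × ℕ → ℝ}
    (hk : SatisfiesCoeffCasimir a b Δ ℓ k) (hk' : SatisfiesCoeffCasimir a b Δ ℓ k') :
    SatisfiesCoeffCasimir a b Δ ℓ (k - k') := by
  intro P Q
  rw [coeffCasimirLHS_sub, hk P Q, hk' P Q, sub_zero]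

/-! ### The triangular induction -/

namespace SatisfiesCoeffCasimir

variable {a b Δ : ℝ} {ℓ : ℕ} {d : ℕ × ℕ → ℝ}

/-- The equation of the monomial `(N+1, 0)` when everything below degree `N` vanishes:
`A(N,0) · d_{N,0} = 0` (the pure-`z` chain). [cite: DolanOsborn2011, §2 eqs. (2.10)–(2.12)] -/
theorem coeffA_mul_eq_zero_fst (hd : SatisfiesCoeffCasimir a b Δ ℓ d) (N : ℕ)
    (hlow : ∀ m n : ℕ, m + n < N → d (m, n) = 0) : coeffA Δ ℓ N 0 * d (N, 0) = 0 := by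
  have h := hd (N + 1) 0
  simp only [coeffCasimirLHS] at h
  have hC : (if 2 ≤ N + 1 then coeffC a b Δ ℓ (N + 1 - 2) * d (N + 1 - 2, 0) else 0) = 0 := by
    split_ifs with h2
    · have : d (N + 1 - 2, 0) = 0 := hlow _ _ (by omega)
      rw [this, mul_zero]
    · rfl
  rw [hC] at h
  simpa using h

/-- The equation of the monomial `(m+1, n+1)` when everything below degree `N = m + n + 1` vanishes and
the previous unknown `d_{m+1,n}` of the same degree vanishes: `A(m,n+1) · d_{m,n+1} = 0`.
[cite: DolanOsborn2011, §2 eqs. (2.10)–(2.12)] -/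
theorem coeffA_mul_eq_zero_succ (hd : SatisfiesCoeffCasimir a b Δ ℓ d) (m n : ℕ)
    (hlow : ∀ m' n' : ℕ, m' + n' < m + n + 1 → d (m', n') = 0) (hprev : d (m + 1, n) = 0) :
    coeffA Δ ℓ m (n + 1) * d (m, n + 1) = 0 := by
  have h := hd (m + 1) (n + 1)
  simp only [coeffCasimirLHS] at h
  have hB : (if 1 ≤ n + 1 then coeffB Δ ℓ (m + 1) (n + 1 - 1) * d (m + 1, n + 1 - 1) else 0) = 0 := by
    rw [if_pos (by omega)]
    simp [hprev]
  have hC : (if 2 ≤ m + 1 then coeffC a b Δ ℓ (m + 1 - 2) * d (m + 1 - 2, n + 1) else 0) = 0 := by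
    split_ifs with h2
    · have : d (m + 1 - 2, n + 1) = 0 := hlow _ _ (by omega)
      rw [this, mul_zero]
    · rfl
  have hD : (if 1 ≤ m + 1 ∧ 1 ≤ n + 1 then
      coeffD a b Δ ℓ (m + 1 - 1) (n + 1 - 1) * d (m + 1 - 1, n + 1 - 1) else 0) = 0 := by
    rw [if_pos ⟨by omega, by omega⟩]
    have : d (m + 1 - 1, n + 1 - 1) = 0 := hlow _ _ (by omega)
    rw [this, mul_zero]
  have hE : (if 2 ≤ n + 1 then coeffE a b Δ ℓ (n + 1 - 2) * d (m + 1, n + 1 - 2) else 0) = 0 := by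
    split_ifs with h2
    · have : d (m + 1, n + 1 - 2) = 0 := hlow _ _ (by omega)
      rw [this, mul_zero]
    · rfl
  rw [hB, hC, hD, hE] at h
  simpa using h

/-- **One degree of the triangular induction.** If a symmetric solution vanishes in all degrees `< N`,
and at every position `(m,n)` of degree `N` with `n ≤ m` either the pivot `A(m,n)` is non-zero or the
coefficient is already known to vanish, then the whole degree `N` vanishes. (Inner induction on
`Q = n`: equation `(N+1-Q, Q)` isolates `u_Q = d_{N-Q,Q}` given `u_{Q-1}` and degree `N-1`.)
[cite: HogervorstRychkov2013, §3] -/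
theorem degree_step (hd : SatisfiesCoeffCasimir a b Δ ℓ d) (hsym : ∀ p : ℕ × ℕ, d (p.2, p.1) = d p)
    (N : ℕ) (hlow : ∀ m n : ℕ, m + n < N → d (m, n) = 0)
    (hpiv : ∀ m n : ℕ, m + n = N → n ≤ m → coeffA Δ ℓ m n ≠ 0 ∨ d (m, n) = 0) :
    ∀ m n : ℕ, m + n = N → d (m, n) = 0 := by
  -- inner induction on `n` for the positions with `n ≤ m`
  have key : ∀ n m : ℕ, m + n = N → n ≤ m → d (m, n) = 0 := by
    intro n
    induction n with
    | zero =>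
      intro m hm _
      have hmN : m = N := by omega
      subst hmN
      rcases hpiv m 0 (by omega) (Nat.zero_le _) with hA | h0
      · have h := coeffA_mul_eq_zero_fst hd m hlow
        rcases mul_eq_zero.mp h with h1 | h1
        · exact absurd h1 hA
        · exact h1
      · exact h0
    | succ n ih =>
      intro m hm hnm
      rcases hpiv m (n + 1) hm hnm with hA | h0
      · have hprev : d (m + 1, n) = 0 := ih (m + 1) (by omega) (by omega)
        have h := coeffA_mul_eq_zero_succ hd m n (fun m' n' h' => hlow m' n' (by omega)) hprev
        rcases mul_eq_zero.mp h with h1 | h1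
        · exact absurd h1 hA
        · exact h1
      · exact h0
  intro m n hmn
  rcases le_or_gt n m with hnm | hmn'
  · exact key n m hmn hnm
  · have h := key m n (by omega) hmn'.le
    rw [← hsym (m, n)]
    exact h

/-- **Solutions vanish below degree `ℓ`.** Strictly above the unitarity bound, every symmetric solution
of the coefficient system has `k_{mn} = 0` for `m + n < ℓ` — no boundary condition is used (all pivots of
negative level are non-zero, `coeffA_ne_zero_of_lt`). So `K = (degree ≥ ℓ)`, as the descendant picture
demands. [cite: HogervorstRychkov2013, §3 eq. (3.5)] -/
theorem eq_zero_of_deg_lt {k : ℕ × ℕ → ℝ} (hk : SatisfiesCoeffCasimir a b Δ ℓ k)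
    (hsym : ∀ p : ℕ × ℕ, k (p.2, p.1) = k p) (hΔ : unitarityBound3D ℓ < Δ) :
    ∀ N : ℕ, N < ℓ → ∀ m n : ℕ, m + n = N → k (m, n) = 0 := by
  intro N
  induction N using Nat.strong_induction_on with
  | _ N ih =>
    intro hN
    refine degree_step hk hsym N (fun m n hmn => ih (m + n) hmn (by omega) m n rfl) ?_
    intro m n hmn _
    exact Or.inl (coeffA_ne_zero_of_lt hΔ (by omega))

/-- **The homogeneous system has only the trivial solution with vanishing seed.** Strictly above the
unitarity bound and off the accidental-degeneracy set, a symmetric solution with `d_{ℓ,0} = 0` is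
identically zero (strong induction on the degree with `degree_step`; pivots: `coeffA_ne_zero_of_lt`
below `ℓ`, `coeffA_ne_zero_of_deg_eq` at `ℓ` away from the seed, `coeffA_ne_zero_of_gt` above `ℓ`).
[cite: HogervorstRychkov2013, §3] -/
theorem eq_zero_of_seed_eq_zero (hd : SatisfiesCoeffCasimir a b Δ ℓ d)
    (hsym : ∀ p : ℕ × ℕ, d (p.2, p.1) = d p) (hΔ : unitarityBound3D ℓ < Δ)
    (hreg : ¬ accidentalDegeneracy3D Δ ℓ) (hseed : d (ℓ, 0) = 0) : d = 0 := by
  have main : ∀ N m n : ℕ, m + n = N → d (m, n) = 0 := by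
    intro N
    induction N using Nat.strong_induction_on with
    | _ N ih =>
      refine degree_step hd hsym N (fun m n hmn => ih (m + n) hmn m n rfl) ?_
      intro m n hmn hnm
      rcases Nat.lt_trichotomy N ℓ with hlt | heq | hgt
      · exact Or.inl (coeffA_ne_zero_of_lt hΔ (by omega))
      · rcases Nat.eq_zero_or_pos n with hn | hn
        · subst hn
          have hm : m = ℓ := by omega
          subst hm
          exact Or.inr hseed
        · exact Or.inl (coeffA_ne_zero_of_deg_eq Δ (by omega) hn)
      · exact Or.inl (coeffA_ne_zero_of_gt hreg (by omega) hnm)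
  funext p
  exact main (p.1 + p.2) p.1 p.2 rfl

/-- **(U) Uniqueness of the block coefficients.** Strictly above the 3D unitarity bound and off the
accidental-degeneracy set `accidentalDegeneracy3D Δ ℓ`, two symmetric coefficient arrays satisfying the
coefficient Casimir system and the Dolan–Osborn boundary condition `HasLeadingPart ℓ` are equal — for
every `(a, b)`, i.e. also for the unequal-dimension blocks of the `σ×ε` channel. This is the uniqueness
half of pub-ising3d REFEREE T1 in the form F23 describes, minus the Gegenbauer diagonalisation (the
monomial system is already triangular). (Hogervorst–Rychkov 2013, §3: the recursion determines the
coefficients from `A_{0,j} = δ_{jℓ}`.) [cite: HogervorstRychkov2013, §3 eq. (3.9)] -/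
theorem unique {k k' : ℕ × ℕ → ℝ} (hΔ : unitarityBound3D ℓ < Δ) (hreg : ¬ accidentalDegeneracy3D Δ ℓ)
    (hk : SatisfiesCoeffCasimir a b Δ ℓ k) (hk' : SatisfiesCoeffCasimir a b Δ ℓ k')
    (hks : ∀ p : ℕ × ℕ, k (p.2, p.1) = k p) (hk's : ∀ p : ℕ × ℕ, k' (p.2, p.1) = k' p)
    (hkl : HasLeadingPart ℓ k) (hk'l : HasLeadingPart ℓ k') : k = k' := by
  have hd := eq_zero_of_seed_eq_zero (hk.sub hk') (fun p => by
      simp only [Pi.sub_apply, hks p, hk's p]) hΔ hreg (by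
      simp only [Pi.sub_apply, hkl.2, hk'l.2, sub_self])
  exact sub_eq_zero.mp hd

/-- At a regular point (`IsRegularPoint3D`: neither the bound nor an accidental degeneracy) strictly
above the bound the hypotheses of `unique` hold; convenience form. [cite: HogervorstRychkov2013, §3 eq. (3.9)] -/
theorem unique_of_isRegularPoint3D {k k' : ℕ × ℕ → ℝ} (hΔ : unitarityBound3D ℓ < Δ)
    (hreg : IsRegularPoint3D Δ ℓ)
    (hk : SatisfiesCoeffCasimir a b Δ ℓ k) (hk' : SatisfiesCoeffCasimir a b Δ ℓ k')
    (hks : ∀ p : ℕ × ℕ, k (p.2, p.1) = k p) (hk's : ∀ p : ℕ × ℕ, k' (p.2, p.1) = k' p)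
    (hkl : HasLeadingPart ℓ k) (hk'l : HasLeadingPart ℓ k') : k = k' :=
  unique hΔ hreg.2 hk hk' hks hk's hkl hk'l

end SatisfiesCoeffCasimir

/-! ### Diagonal coefficients -/

/-- The diagonal coefficients of a solution vanish below degree `ℓ` (above the bound), so
`g(x,x) = Σ_{n ≥ 0} d_{ℓ+n} x^{Δ+n}` starts at `x^Δ`. [cite: HogervorstRychkov2013, §3 eq. (3.4)] -/
theorem diagCoeff_eq_zero_of_lt {a b Δ : ℝ} {ℓ : ℕ} {k : ℕ × ℕ → ℝ}
    (hk : SatisfiesCoeffCasimir a b Δ ℓ k) (hsym : ∀ p : ℕ × ℕ, k (p.2, p.1) = k p)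
    (hΔ : unitarityBound3D ℓ < Δ) {N : ℕ} (hN : N < ℓ) : diagCoeff k N = 0 := by
  unfold diagCoeff
  refine Finset.sum_eq_zero fun p hp => ?_
  rw [mem_antidiagonal] at hp
  have := hk.eq_zero_of_deg_lt hsym hΔ N hN p.1 p.2 hp
  simpa using this

/-- The seed degree: `d_ℓ = Σ_{m+n=ℓ} k_{mn}` contains `k_{ℓ0} = 1`; recorded as the trivial rewriting
`diagCoeff k ℓ = 1 + Σ_{m+n=ℓ, (m,n) ≠ (ℓ,0)} k_{mn}` is not needed — what certificates use is that two
solutions have the same diagonal. [cite: HogervorstRychkov2013, §3 eq. (3.4)] -/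
theorem diagCoeff_congr {k k' : ℕ × ℕ → ℝ} (h : k = k') (N : ℕ) : diagCoeff k N = diagCoeff k' N := by
  rw [h]

end Literature.MathematicalPhysics.QuantumFieldTheory.ConformalBootstrap3D
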